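import Summits.BirchSwinnertonDyer.BirchSwinnertonDyer.Theorems.KimAtThreeFineKatoExpStarGalois
import Literature.NumberTheory.GaloisRepresentations.RestrictFieldSemisimple
import HarnessLib

/-!
# The transported conjugation `s : Γ_L → Γ_L` of a Galois extension `L/K` — input (a) of the decomposition-group
# equivariance (GAL_D) of the defined `exp*` (sibling `KimAtThreeFineKatoExpStarGalois.expStarOmega_galois`,
# hypothesis `hs`) (crux `KatoKuriharaPortThreeShared`, stmt-BirchSwinnertonDyer-19560; cell `bsd-addord`, seat kim3
# gen 15 = the crux's LEAD; route W2 `KimAtThreeKolyvagin`; `--supports 19560`, helper)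

TOOL theorem only (Galois bookkeeping, nothing about a curve; no definition, no named fact, no `sorry`); closes
nothing; nothing is booked.  For `δ' ∈ Γ_K` and `L/K` Galois, `τ ↦ res⁻¹(δ'⁻¹ · res τ · δ')` is a continuous group
homomorphism of `Γ_L` (the image of `res` is normal; `res` is a closed embedding).  Consumer: w2-acc5's Galois half
of (GAL_D) at `K = ℚ_v`, `L = L_{w₀}` (cyclotomic completions are Galois, w2-kport `Kw.isGalois_adicCompletion`).

Reference: J.-P. Serre, *Local Fields* (1979) VII §5 [SerreLocalFields1979].
-/

set_option autoImplicit false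
-- the Theorems namespace of a single-conjunct summit repeats the summit name by design (D-0017)
set_option linter.dupNamespace false

noncomputable section

open Field Function
open Literature.NumberTheory.GaloisRepresentations

namespace Summit.BirchSwinnertonDyer.BirchSwinnertonDyer.Theorems.KimAtThreeFineKatoExpStarGalois

section Conj

variable {K L : Type} [Field K] [Field L] [Algebra K L] [CharZero L]

/-- **Conjugation by `δ' ∈ Γ_K` transported to `Γ_L`** for a Galois extension `L/K`: the image of
`res : Γ_L → Γ_K` is normal (`normal_range_absGaloisRestrict`), so `τ ↦ res⁻¹(δ'⁻¹ · res τ · δ')` is a continuous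
group homomorphism `s : Γ_L → Γ_L` with `res (s τ) = δ'⁻¹ · res τ · δ'` (`res` is injective, and a closed embedding
since `Γ_L` is compact and `Γ_K` Hausdorff).  This is the hypothesis `hs` of `expStarOmega_galois`.
[cite: SerreLocalFields1979, VII §5] -/
theorem exists_conjTransport [IsGalois K L] (δ' : absoluteGaloisGroup K) :
    ∃ s : absoluteGaloisGroup L →ₜ* absoluteGaloisGroup L,
      ∀ τ, absGaloisRestrict K L (s τ) = δ'⁻¹ * absGaloisRestrict K L τ * δ' := by
  have hN := normal_range_absGaloisRestrict K L
  have hmem : ∀ τ, δ'⁻¹ * absGaloisRestrict K L τ * δ' ∈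
      ((absGaloisRestrict K L).range : Subgroup (absoluteGaloisGroup K)) := fun τ => by
    have h := hN.conj_mem _ ⟨τ, rfl⟩ δ'⁻¹
    rwa [inv_inv] at h
  choose f hf using hmem
  have hf' : ∀ τ, absGaloisRestrict K L (f τ) = δ'⁻¹ * absGaloisRestrict K L τ * δ' := fun τ => hf τ
  have hinj : Injective (absGaloisRestrict K L) := absGaloisRestrict_injective (K := K) (L := L)
  -- `f` is a group homomorphism
  let s₀ : absoluteGaloisGroup L →* absoluteGaloisGroup L :=
    { toFun := f
      map_one' := hinj (by rw [hf', map_one]; group)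
      map_mul' := fun a b => hinj (by rw [hf', map_mul, map_mul, hf', hf']; group) }
  -- `f` is continuous: `res` is a closed embedding and `res ∘ f` is continuous
  have hemb : Topology.IsClosedEmbedding (absGaloisRestrict K L) :=
    (absGaloisRestrict K L).continuous.isClosedEmbedding hinj
  have hcont : Continuous f := by
    rw [hemb.isEmbedding.continuous_iff]
    have hcomp : (absGaloisRestrict K L) ∘ f = fun τ => δ'⁻¹ * absGaloisRestrict K L τ * δ' := funext hf'
    rw [hcomp]
    exact (continuous_const.mul (absGaloisRestrict K L).continuous).mul continuous_const
  exact ⟨⟨s₀, hcont⟩, hf'⟩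

end Conj

end Summit.BirchSwinnertonDyer.BirchSwinnertonDyer.Theorems.KimAtThreeFineKatoExpStarGalois

end
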